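import Summits.KontsevichZagierPeriods.KontsevichZagierPeriods.Theorems.EllipticMomentKernel.Negative.GeneralCurve
import Literature.NumberTheory.Transcendental.KZLogCalculusProofs
import Literature.NumberTheory.Transcendental.KZSemiCanonicalReductionProofs

/-!
# `EllipticMomentKernel` (stmt-KontsevichZagierPeriods-10631), line `merge-first-single-hermite`:
# stub `stub_columnMove`

THE COLUMN MOVE. For a rational Weierstrass cubic `f = cubic q₂ q₃ = 4x³ − q₂x − q₃`
with `disc > 0` (bounded oval `σ = oval q₂ q₃ = (e₃, e₂)`, region `D = underGraph q₂ q₃ =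
{(x, y) | x ∈ σ, 0 < y, y² < f x}` under the graph of `√f`), every moment `[D, x^a y^b]` is
congruent modulo `KZ.relations` to `[σ, x^a (√f)^{b+1}/(b+1)]`:

* ONE Newton–Leibniz move (KZ rule (3), `KZ.newtonLeibnizRel`) ALONG `y` over the OPEN base
  `σ ⊆ ℝ¹`, with the semialgebraic bounds `0 ≤ y ≤ √f(x)`, the CLOSED band
  `B = KZlog.band σ 0 √f`, the polynomial band integrand `x^a y^b` and the POLYNOMIAL primitive
  `F(x, y) = x^a y^{b+1}/(b+1)` (`∂F/∂y = x^a y^b`,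
  `F(x, √f x) − F(x, 0) = x^a (√f x)^{b+1}/(b+1)`);
* the open `D` and the closed band `B` differ by the two null graphs `y = 0` and `y = √f(x)`
  (`KZ.of_sub_of_mem_relations_of_null`);
* the base representation and the given `s` have the same domain `σ` and integrands agreeing on
  it (`KZ.of_sub_of_mem_relations_of_eqOn`).
-/

noncomputable section

open MeasureTheory Set
open scoped Polynomial

namespace Summit.KontsevichZagierPeriods.HermiteRigidity.EllipticMomentKernel

open Literature.NumberTheory.Transcendental
open Literature.NumberTheory.Transcendental.KZ
open Summit.KontsevichZagierPeriods.HermiteRigidity.EllipticMomentKernelNegative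
open Summit.KontsevichZagierPeriods.KontsevichZagierPeriods.Theses.HermiteRigidity
  (EllipticMomentKernel HermiteExactFormVanishes)
open Literature.ModelTheory.ExponentialFields (IsSemialgebraic)

/-! ## Semialgebraic bookkeeping -/

/-- Natural powers of a real `ℚ`-semialgebraic function are `ℚ`-semialgebraic (induction on the
exponent from the product rule). [cite: BochnakCosteRoy1998, Prop. 2.2.6] -/
theorem columnMove_isSemialgebraicFunOn_pow {m : ℕ} {s : Set (Fin m → ℝ)}
    {f : (Fin m → ℝ) → ℝ} (hf : IsSemialgebraicFunOn ℚ s f) (n : ℕ) :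
    IsSemialgebraicFunOn ℚ s (fun x => f x ^ n) := by
  induction n with
  | zero =>
    exact (isSemialgebraicFunOn_ratCast (IsSemialgebraicFunOn.isSemialgebraic_holds hf) 1).congr
      fun x _ => by simp
  | succ n ih =>
    exact (IsSemialgebraicFunOn.mul_holds ih hf).congr fun x _ => by simp [pow_succ]

/-- The upper edge `x ↦ √f(x)` of the band is `ℚ`-semialgebraic on the oval `σ`.
[cite: BochnakCosteRoy1998, Prop. 2.2.6] -/
theorem columnMove_isSemialgebraicFunOn_sqrt {q₂ q₃ : ℚ} (hΔ : 0 < disc q₂ q₃) :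
    IsSemialgebraicFunOn ℚ (oval q₂ q₃) (fun x => Real.sqrt (cubic q₂ q₃ (x 0))) :=
  (IsSemialgebraicFunOn.sqrt_holds
    (isSemialgebraicFunOn_aeval (isSemialgebraic_oval hΔ) (cubicPolyQ q₂ q₃))).congr
    fun x _ => by simp only [aeval_cubicPolyQ]

/-- The lower edge `x ↦ 0` of the band is `ℚ`-semialgebraic on the oval `σ`. [folklore] -/
theorem columnMove_isSemialgebraicFunOn_zero {q₂ q₃ : ℚ} (hΔ : 0 < disc q₂ q₃) :
    IsSemialgebraicFunOn ℚ (oval q₂ q₃) (fun _ => (0 : ℝ)) :=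
  (isSemialgebraicFunOn_ratCast (isSemialgebraic_oval hΔ) 0).congr fun _ _ => by simp

/-- The base integrand `x ↦ x^a (√f x)^{b+1}/(b+1)` is `ℚ`-semialgebraic on `σ` (a polynomial
times a power of the semialgebraic `√f`). [cite: BochnakCosteRoy1998, Prop. 2.2.6] -/
theorem columnMove_isSemialgebraicFunOn_base {q₂ q₃ : ℚ} (hΔ : 0 < disc q₂ q₃) (a b : ℕ) :
    IsSemialgebraicFunOn ℚ (oval q₂ q₃)
      (fun x => x 0 ^ a * Real.sqrt (cubic q₂ q₃ (x 0)) ^ (b + 1) / ((b : ℝ) + 1)) := by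
  have h1 : IsSemialgebraicFunOn ℚ (oval q₂ q₃) (fun x => MvPolynomial.aeval x
      (MvPolynomial.C (1 / ((b : ℚ) + 1)) * MvPolynomial.X 0 ^ a : MvPolynomial (Fin 1) ℚ)) :=
    isSemialgebraicFunOn_aeval (isSemialgebraic_oval hΔ) _
  have h2 :=
    columnMove_isSemialgebraicFunOn_pow (columnMove_isSemialgebraicFunOn_sqrt hΔ) (b + 1)
  refine (IsSemialgebraicFunOn.mul_holds h1 h2).congr fun x _ => ?_
  simp only [Pi.mul_apply, map_mul, MvPolynomial.aeval_C, map_pow, MvPolynomial.aeval_X,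
    eq_ratCast]
  push_cast
  ring

/-- The closed band `B = {(x, y) | x ∈ σ, 0 ≤ y ≤ √f(x)}` is `ℚ`-semialgebraic.
[cite: BochnakCosteRoy1998, Prop. 2.2.6] -/
theorem columnMove_isSemialgebraic_band {q₂ q₃ : ℚ} (hΔ : 0 < disc q₂ q₃) :
    IsSemialgebraic ℚ (KZlog.band (oval q₂ q₃) (fun _ => (0 : ℝ))
      (fun x => Real.sqrt (cubic q₂ q₃ (x 0)))) :=
  KZlog.isSemialgebraic_band (columnMove_isSemialgebraicFunOn_zero hΔ)
    (columnMove_isSemialgebraicFunOn_sqrt hΔ)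

/-! ## Integrability bookkeeping -/

/-- The base integrand `x ↦ x^a (√f x)^{b+1}/(b+1)` is integrable on `σ = (e₃, e₂)`: it is
continuous on `ℝ¹` and `σ` lies in the compact interval `[e₃, e₂]`. [folklore] -/
theorem columnMove_integrableOn_base {q₂ q₃ : ℚ} (hΔ : 0 < disc q₂ q₃) (a b : ℕ) :
    IntegrableOn (fun x : Fin 1 → ℝ =>
      x 0 ^ a * Real.sqrt (cubic q₂ q₃ (x 0)) ^ (b + 1) / ((b : ℝ) + 1)) (oval q₂ q₃) := by
  obtain ⟨e₃, e₂, e₁, h3, h2a, h2b, h1, hf⟩ := exists_roots hΔ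
  have h32 : e₃ < e₂ := by linarith
  have h21 : e₂ < e₁ := by linarith
  have hsub : oval q₂ q₃ ⊆ Icc (fun _ => e₃) (fun _ => e₂) := by
    rw [oval_eq_of_roots h32 h21 hf]
    intro p hp
    simp only [mem_Icc, Pi.le_def, Fin.forall_fin_one]
    exact ⟨hp.1.le, hp.2.le⟩
  have hcont : Continuous (fun x : Fin 1 → ℝ =>
      x 0 ^ a * Real.sqrt (cubic q₂ q₃ (x 0)) ^ (b + 1) / ((b : ℝ) + 1)) :=
    (((continuous_apply 0).pow a).mul ((Real.continuous_sqrt.comp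
      ((continuous_cubic (q₂ := q₂) (q₃ := q₃)).comp (continuous_apply 0))).pow
        (b + 1))).div_const _
  exact (hcont.continuousOn.integrableOn_compact isCompact_Icc).mono_set hsub

/-- The band integrand `(x, y) ↦ x^a y^b` is integrable on the closed band `B`: it is
continuous on `ℝ²` and `B` lies in the compact box `[e₃, e₂] × [0, √C]`, `C` a bound of `f` on
`[e₃, e₂]`. [folklore] -/
theorem columnMove_integrableOn_band {q₂ q₃ : ℚ} (hΔ : 0 < disc q₂ q₃) (a b : ℕ) :
    IntegrableOn (fun z : Fin 2 → ℝ => z 0 ^ a * z 1 ^ b)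
      (KZlog.band (oval q₂ q₃) (fun _ => (0 : ℝ))
        (fun x => Real.sqrt (cubic q₂ q₃ (x 0)))) := by
  obtain ⟨e₃, e₂, e₁, h3, h2a, h2b, h1, hf⟩ := exists_roots hΔ
  have h32 : e₃ < e₂ := by linarith
  have h21 : e₂ < e₁ := by linarith
  obtain ⟨C, hC⟩ := (isCompact_Icc : IsCompact (Icc e₃ e₂)).exists_bound_of_continuousOn
    (continuous_cubic (q₂ := q₂) (q₃ := q₃)).continuousOn
  -- the compact box `[e₃, e₂] × [0, √C] ⊆ ℝ²`
  set l : Fin 2 → ℝ := fun i => if i = 0 then e₃ else 0 with hl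
  set u : Fin 2 → ℝ := fun i => if i = 0 then e₂ else Real.sqrt C with hu
  have hsub : (KZlog.band (oval q₂ q₃) (fun _ => (0 : ℝ))
      (fun x => Real.sqrt (cubic q₂ q₃ (x 0))) : Set (Fin 2 → ℝ)) ⊆ Icc l u := by
    rw [oval_eq_of_roots h32 h21 hf]
    rintro z ⟨hz0, hz1, hz2⟩
    have hz0' : z 0 ∈ Ioo e₃ e₂ := hz0
    have hfC : cubic q₂ q₃ (z 0) ≤ C :=
      (le_abs_self _).trans ((Real.norm_eq_abs _).symm.le.trans (hC _ ⟨hz0'.1.le, hz0'.2.le⟩))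
    have h1C : z 1 ≤ Real.sqrt C := hz2.trans (Real.sqrt_le_sqrt hfC)
    refine ⟨fun i => ?_, fun i => ?_⟩
    · by_cases hi : i = 0
      · subst hi; simpa [hl] using hz0'.1.le
      · rw [Fin.eq_one_of_ne_zero i hi]; simpa [hl] using hz1
    · by_cases hi : i = 0
      · subst hi; simpa [hu] using hz0'.2.le
      · rw [Fin.eq_one_of_ne_zero i hi]; simpa [hu] using h1C
  have hcont : Continuous (fun z : Fin 2 → ℝ => z 0 ^ a * z 1 ^ b) :=
    ((continuous_apply 0).pow a).mul ((continuous_apply 1).pow b)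
  exact (hcont.continuousOn.integrableOn_compact isCompact_Icc).mono_set hsub

/-! ## The stub -/

/-- **Stub `stub_columnMove`**: ONE Newton–Leibniz move along `y` — KZ rule (3) over the OPEN
base `σ ⊆ ℝ¹` with the semialgebraic bounds `0 ≤ y ≤ √f(x)` and the POLYNOMIAL primitive
`F(x, y) = x^a y^{b+1}/(b+1)` (`∂F/∂y = x^a y^b`,
`F(x, √f x) − F(x, 0) = x^a (√f x)^{b+1}/(b+1)`) — turns the moment `[D, x^a y^b]` into
`[σ, x^a (√f)^{b+1}/(b+1)]`; the open `D = {x ∈ σ, 0 < y, y² < f x}` and the closed band differ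
by two null graphs (`y = 0`, `y = √f x`), and the base representation is congruent to any
`s = [σ, x^a (√f)^{b+1}/(b+1)]`. [cite: KontsevichZagier2001, §1.2 rule (3)] -/
theorem stub_columnMove (q₂ q₃ : ℚ) (hΔ : 0 < disc q₂ q₃) (a b : ℕ) (r : IntegralRep 2)
    (hr : r.domain = underGraph q₂ q₃)
    (hri : EqOn r.integrand (fun p => p 0 ^ a * p 1 ^ b) (underGraph q₂ q₃))
    (s : IntegralRep 1) (hs : s.domain = oval q₂ q₃)
    (hsi : EqOn s.integrand
      (fun p => p 0 ^ a * Real.sqrt (cubic q₂ q₃ (p 0)) ^ (b + 1) / ((b : ℝ) + 1)) (oval q₂ q₃)) :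
    KZ.of r - KZ.of s ∈ KZ.relations := by
  have hB := columnMove_isSemialgebraic_band hΔ
  have hhi := columnMove_isSemialgebraicFunOn_sqrt hΔ
  -- the band representation `R = [B, x^a y^b]`
  obtain ⟨R, hRd, hRi⟩ : ∃ R : IntegralRep 2,
      R.domain = KZlog.band (oval q₂ q₃) (fun _ => (0 : ℝ))
        (fun x => Real.sqrt (cubic q₂ q₃ (x 0))) ∧
      R.integrand = fun z => z 0 ^ a * z 1 ^ b :=
    ⟨{ domain := KZlog.band (oval q₂ q₃) (fun _ => (0 : ℝ))
           (fun x => Real.sqrt (cubic q₂ q₃ (x 0)))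
       integrand := fun z => z 0 ^ a * z 1 ^ b
       isSemialgebraic_domain := hB
       isSemialgebraicFunOn_integrand :=
         (isSemialgebraicFunOn_aeval hB
           (MvPolynomial.X 0 ^ a * MvPolynomial.X 1 ^ b : MvPolynomial (Fin 2) ℚ)).congr
           fun z _ => by simp
       integrableOn := columnMove_integrableOn_band hΔ a b }, rfl, rfl⟩
  -- the base representation `r' = [σ, x^a (√f)^{b+1}/(b+1)]`
  obtain ⟨r', hr'd, hr'i⟩ : ∃ r' : IntegralRep 1, r'.domain = oval q₂ q₃ ∧
      r'.integrand =
        fun x => x 0 ^ a * Real.sqrt (cubic q₂ q₃ (x 0)) ^ (b + 1) / ((b : ℝ) + 1) :=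
    ⟨{ domain := oval q₂ q₃
       integrand :=
         fun x => x 0 ^ a * Real.sqrt (cubic q₂ q₃ (x 0)) ^ (b + 1) / ((b : ℝ) + 1)
       isSemialgebraic_domain := isSemialgebraic_oval hΔ
       isSemialgebraicFunOn_integrand := columnMove_isSemialgebraicFunOn_base hΔ a b
       integrableOn := columnMove_integrableOn_base hΔ a b }, rfl, rfl⟩
  -- `Fin 2` bookkeeping
  have hs0 : ∀ (x : Fin 1 → ℝ) (t : ℝ), (Fin.snoc x t : Fin 2 → ℝ) 0 = x 0 := fun x t =>
    Fin.snoc_apply_zero (α := fun _ => ℝ) t x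
  have hs1 : ∀ (x : Fin 1 → ℝ) (t : ℝ), (Fin.snoc x t : Fin 2 → ℝ) 1 = t := fun x t =>
    Fin.snoc_last (α := fun _ => ℝ) t x
  -- (i) the Newton–Leibniz move `[R] − [r'] ∈ newtonLeibnizRel`
  have h1 : KZ.of R - KZ.of r' ∈ newtonLeibnizRel := by
    refine ⟨1, R, r', fun _ => (0 : ℝ), fun x => Real.sqrt (cubic q₂ q₃ (x 0)),
      fun z => z 0 ^ a * z 1 ^ (b + 1) / ((b : ℝ) + 1), ?_, ?_, ?_,
      fun x _ => Real.sqrt_nonneg _, ?_, ?_, ?_, ?_, rfl⟩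
    · -- the primitive `F = (1/(b+1)) X₀^a X₁^{b+1}` is a polynomial, semialgebraic on the band
      rw [hRd]
      refine (isSemialgebraicFunOn_aeval hB (MvPolynomial.C (1 / ((b : ℚ) + 1)) *
        MvPolynomial.X 0 ^ a * MvPolynomial.X 1 ^ (b + 1) : MvPolynomial (Fin 2) ℚ)).congr
        fun z _ => ?_
      simp only [map_mul, MvPolynomial.aeval_C, map_pow, MvPolynomial.aeval_X, eq_ratCast]
      push_cast
      ring
    · rw [hr'd]; exact columnMove_isSemialgebraicFunOn_zero hΔ
    · rw [hr'd]; exact hhi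
    · rw [hRd, hr'd]; rfl
    · -- continuity of `t ↦ F(x, t)` on the closed fibre
      intro x _
      simp only [hs0, hs1]
      exact (((continuous_const.mul (continuous_pow (b + 1))).div_const _).continuousOn :
        ContinuousOn (fun t : ℝ => x 0 ^ a * t ^ (b + 1) / ((b : ℝ) + 1)) _)
    · -- `∂F/∂t (x, t) = x^a t^b = R.integrand (x, t)` on the open fibre
      intro x _ t _
      rw [hRi]
      simp only [hs0, hs1]
      refine (((hasDerivAt_pow (b + 1) t).const_mul (x 0 ^ a)).div_const
        ((b : ℝ) + 1)).congr_deriv ?_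
      have hb1 : ((b : ℝ) + 1) ≠ 0 := by positivity
      simp only [Nat.add_sub_cancel]
      push_cast
      field_simp
    · -- the boundary term `F(x, √f x) − F(x, 0) = x^a (√f x)^{b+1}/(b+1)`
      intro x _
      rw [hr'i]
      simp only [hs0, hs1, zero_pow (Nat.succ_ne_zero b), mul_zero, zero_div, sub_zero]
  -- (ii) `[r] − [R] ∈ relations`: `D ⊆ B` and `B ∖ D ⊆ {y = 0} ∪ graph(√f)` is null
  have h2 : KZ.of r - KZ.of R ∈ relations := by
    refine of_sub_of_mem_relations_of_null r R ?_ ?_ ?_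
    · have hsub : r.domain ⊆ R.domain := by
        rw [hr, hRd]
        rintro p ⟨hp0, hp1, hp2⟩
        exact ⟨hp0, hp1.le, ((Real.lt_sqrt hp1.le).2 hp2).le⟩
      rw [Set.sdiff_eq_empty.mpr hsub, measure_empty]
    · have hsub : R.domain \ r.domain ⊆ {z : Fin 2 → ℝ | z (Fin.last 1) = 0} ∪
          {z | Fin.init z ∈ oval q₂ q₃ ∧
            z (Fin.last 1) = (fun x => Real.sqrt (cubic q₂ q₃ (x 0))) (Fin.init z)} := by
        rw [hr, hRd]
        rintro z ⟨⟨hz0, hz1, hz2⟩, hzD⟩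
        by_cases h0 : z (Fin.last 1) = 0
        · exact Or.inl h0
        · refine Or.inr ⟨hz0, ?_⟩
          have hpos : 0 < z 1 := lt_of_le_of_ne hz1 (Ne.symm h0)
          have hf0 : 0 < cubic q₂ q₃ (z 0) := hz0.1
          have hle : z 1 ^ 2 ≤ cubic q₂ q₃ (z 0) := (Real.le_sqrt hpos.le hf0.le).1 hz2
          have hge : cubic q₂ q₃ (z 0) ≤ z 1 ^ 2 := not_lt.1 fun hlt => hzD ⟨hz0, hpos, hlt⟩
          show z 1 = Real.sqrt (cubic q₂ q₃ (z 0))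
          rw [← le_antisymm hle hge, Real.sqrt_sq hpos.le]
      exact measure_mono_null hsub
        (measure_union_null (volume_setOf_last_eq_zero 0) (volume_graph_eq_zero hhi))
    · rintro p ⟨hp, -⟩
      rw [hr] at hp
      rw [hRi]
      exact hri hp
  -- (iii) `[r'] − [s] ∈ relations`: same domain, integrands agree on it
  have h3 : KZ.of r' - KZ.of s ∈ relations := by
    refine of_sub_of_mem_relations_of_eqOn (hs.trans hr'd.symm) ?_
    rw [hr'd, hr'i]
    exact fun x hx => (hsi hx).symm
  have : KZ.of r - KZ.of s =
      (KZ.of r - KZ.of R) + (KZ.of R - KZ.of r') + (KZ.of r' - KZ.of s) := by abel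
  rw [this]
  exact relations.add_mem (relations.add_mem h2 (newtonLeibnizRel_subset_relations h1)) h3

end Summit.KontsevichZagierPeriods.HermiteRigidity.EllipticMomentKernel
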